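import Summits.CriticalPhenomena.PercolationContinuityZ3.Theorems.PercNearOneGluingNoHeavyLowerTailSahiSlotCell34Search
import Summits.CriticalPhenomena.PercolationContinuityZ3.Theorems.PercNearOneGluingNoHeavyLowerTailSahiSlotCell34Ident
import Summits.CriticalPhenomena.PercolationContinuityZ3.Theorems.PercNearOneGluingNoHeavyLowerTailSahiSlotPatternSymm

/-!
# The cell `(3,4)` in the kernel, V: COLOURINGS — restricted growth covers all colourings; the searched family is the coloured-antichain family

Support file of the one-cut programme (crux `NoHeavyLowerTail`, stmt-CriticalPhenomena-4575; cell `prim-masterthm`, seat P3, gen 19;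
`run/shared/lean/prim/prim-masterthm/prim-masterthm-p3/HIERARCHY.md` §27).  Companion of `…SahiSlotCell34Check/Facts/Search/Ident`.

* `exists_adm` — every colouring of a list of points is, after a permutation of the four colours, of RESTRICTED GROWTH (`Adm 0`): relabel
  greedily, sending each new colour to the least unused one (one `Equiv.swap` per new colour);
* `testBit_finalD`, `memb_finalD` — the family reached by the search from the empty family along the points of `N` with colours `c` is the
  coloured-antichain family `V_i = {q | ∀ p ∈ N, c p = i → ¬ q ≤ p}` of the saturation reduction (prim-sahi-typer gen 27);
* `patternForm_colourFamily_perm` — permuting the colours permutes the members (`SahiSlot.patternForm_perm_slots`);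
* **`patternForm_colourFamily_nonneg_of_checkMask`** — if `checkMask mkCtx (enc N) = true` then `patternForm 3 4 (1_V) ≥ 0` for EVERY colouring
  `c` of the antichain `N`.
HONEST LABEL: glue; the enumeration of the antichains and the axis symmetry are `…Cell34Cover`, the final theorem `…SahiSlotPatternThreeFour`.
[this work]
-/

namespace Summit.CriticalPhenomena.PercolationContinuityZ3.Theorems

namespace SahiSlot34

open Finset Equiv
open Literature.Combinatorics.Sahi2008 (setInd)

/-! ### Restricted growth covers every colouring -/

/-- A colouring read through a permutation of the four colours. [this work] -/
def relab (π : Perm (Fin 4)) (c : ℕ → ℕ) : ℕ → ℕ := fun p => (π ⟨c p % 4, Nat.mod_lt _ (by norm_num)⟩).val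

/-- Greedy relabelling: with the colours of value `< m` already fixed by `π`, the remaining points can be relabelled into restricted growth.
[this work] -/
theorem exists_adm (c : ℕ → ℕ) : ∀ (pts : List ℕ) (m : ℕ) (_ : m ≤ 4) (π : Perm (Fin 4)),
    ∃ π' : Perm (Fin 4), (∀ j : Fin 4, (π j).val < m → π' j = π j) ∧ Adm m pts (relab π' c) := by
  intro pts
  induction pts with
  | nil => intro m _ π; exact ⟨π, fun _ _ => rfl, trivial⟩
  | cons p rest ih =>
    intro m hm π
    set j : Fin 4 := ⟨c p % 4, Nat.mod_lt _ (by norm_num)⟩ with hj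
    by_cases hlt : (π j).val < m
    · obtain ⟨π', hagree, hadm⟩ := ih m hm π
      refine ⟨π', hagree, ?_⟩
      have hval : relab π' c p = (π j).val := by
        show (π' ⟨c p % 4, _⟩).val = _; rw [← hj, hagree j hlt]
      refine ⟨by rw [hval]; omega, by rw [hval]; exact (π j).isLt, ?_⟩
      rw [hval, max_eq_left (by omega)]; exact hadm
    · have hm4 : m < 4 := by have := (π j).isLt; omega
      set π₁ : Perm (Fin 4) := swap (π j) ⟨m, hm4⟩ * π with hπ₁
      have hπ₁j : π₁ j = ⟨m, hm4⟩ := by rw [hπ₁, Perm.mul_apply, swap_apply_left]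
      obtain ⟨π', hagree, hadm⟩ := ih (m + 1) (by omega) π₁
      have hπ'j : π' j = ⟨m, hm4⟩ := by rw [hagree j (by rw [hπ₁j]; exact Nat.lt_succ_self m), hπ₁j]
      refine ⟨π', fun j' hj' => ?_, ?_⟩
      · have hne1 : π j' ≠ π j := fun h => by rw [h] at hj'; omega
        have hne2 : π j' ≠ ⟨m, hm4⟩ := fun h => by rw [h] at hj'; exact lt_irrefl _ hj'
        have h1 : π₁ j' = π j' := by rw [hπ₁, Perm.mul_apply, swap_apply_of_ne_of_ne hne1 hne2]
        rw [hagree j' (by rw [h1]; omega), h1]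
      · have hval : relab π' c p = m := by
          show (π' ⟨c p % 4, _⟩).val = _; rw [← hj, hπ'j]
        refine ⟨by rw [hval], by rw [hval]; exact hm4, ?_⟩
        rw [hval, max_eq_right (by omega)]; exact hadm

/-- Every colouring is of restricted growth after a permutation of the colours. [this work] -/
theorem exists_adm_zero (c : ℕ → ℕ) (pts : List ℕ) : ∃ π : Perm (Fin 4), Adm 0 pts (relab π c) := by
  obtain ⟨π, -, h⟩ := exists_adm c pts 0 (by norm_num) 1
  exact ⟨π, h⟩

/-! ### Points: codes and decoding -/

/-- The point with code `x`. [this work] -/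
def decode (x : ℕ) : SahiSlot.Q 3 4 := fun a =>
  if a = 0 then ⟨x / 16 % 4, Nat.mod_lt _ (by norm_num)⟩
  else if a = 1 then ⟨x / 4 % 4, Nat.mod_lt _ (by norm_num)⟩ else ⟨x % 4, Nat.mod_lt _ (by norm_num)⟩

/-- `decode ∘ code = id`. [this work] -/
theorem decode_code (q : SahiSlot.Q 3 4) : decode (code q) = q := by
  have h0 := (q 0).isLt; have h1 := (q 1).isLt; have h2 := (q 2).isLt
  funext a
  fin_cases a
  · show (⟨(16 * (q 0).val + 4 * (q 1).val + (q 2).val) / 16 % 4, _⟩ : Fin 4) = q 0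
    exact Fin.ext (by simp only; omega)
  · show (⟨(16 * (q 0).val + 4 * (q 1).val + (q 2).val) / 4 % 4, _⟩ : Fin 4) = q 1
    exact Fin.ext (by simp only; omega)
  · show (⟨(16 * (q 0).val + 4 * (q 1).val + (q 2).val) % 4, _⟩ : Fin 4) = q 2
    exact Fin.ext (by simp only; omega)

/-- `code ∘ decode = id` below `64`. [this work] -/
theorem code_decode {x : ℕ} (hx : x < 64) : code (decode x) = x := by
  unfold code decode
  simp only [show ((1 : Fin 3) = 0) = False by decide, show ((2 : Fin 3) = 0) = False by decide,
    show ((2 : Fin 3) = 1) = False by decide, if_true, if_false]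
  omega

/-- The product order in codes. [this work] -/
theorem cle_code_iff (q p : SahiSlot.Q 3 4) : cle (code q) (code p) = true ↔ q ≤ p := by
  have hx : ∀ r : SahiSlot.Q 3 4, cx (code r) = (r 0).val := fun r => by
    unfold cx code; have := (r 1).isLt; have := (r 2).isLt; omega
  have hy : ∀ r : SahiSlot.Q 3 4, cy (code r) = (r 1).val := fun r => by
    unfold cy code; have := (r 1).isLt; have := (r 2).isLt; omega
  have hz : ∀ r : SahiSlot.Q 3 4, cz (code r) = (r 2).val := fun r => by
    unfold cz code; have := (r 1).isLt; have := (r 2).isLt; omega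
  unfold cle
  rw [hx, hx, hy, hy, hz, hz]
  simp only [Bool.and_eq_true, decide_eq_true_eq]
  constructor
  · rintro ⟨h0, h1, h2⟩ a
    fin_cases a
    · exact Fin.le_def.2 h0
    · exact Fin.le_def.2 h1
    · exact Fin.le_def.2 h2
  · intro h
    exact ⟨Fin.le_def.1 (h 0), Fin.le_def.1 (h 1), Fin.le_def.1 (h 2)⟩

/-! ### The family reached by the search is the coloured-antichain family -/

/-- Bits of the family reached by colouring the points of a list. [this work] -/
theorem testBit_finalD (col : ℕ → ℕ) : ∀ (pts : List ℕ) (d : Fin 4 → ℕ) (i : Fin 4) (x : ℕ),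
    (finalD d pts col i).testBit x = true ↔
      ((d i).testBit x = true ∨ ∃ p ∈ pts, col p % 4 = i.val ∧ (downMask p).testBit x = true) := by
  intro pts
  induction pts with
  | nil => intro d i x; simp [finalD]
  | cons p rest ih =>
    intro d i x
    rw [finalD, ih]
    have hstep : (addDown d ⟨col p % 4, Nat.mod_lt _ (by norm_num)⟩ p i).testBit x = true ↔
        ((d i).testBit x = true ∨ (col p % 4 = i.val ∧ (downMask p).testBit x = true)) := by
      unfold addDown
      by_cases hpi : col p % 4 = i.val
      · have : (⟨col p % 4, Nat.mod_lt _ (by norm_num)⟩ : Fin 4) = i := Fin.ext hpi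
        rw [this, Function.update_self, Nat.testBit_lor]; simp [hpi]
      · have : i ≠ (⟨col p % 4, Nat.mod_lt _ (by norm_num)⟩ : Fin 4) := fun h => hpi (by rw [h])
        rw [Function.update_of_ne this]; simp [hpi]
    rw [hstep]
    constructor
    · rintro ((h | ⟨h1, h2⟩) | ⟨p', hp', h⟩)
      · exact Or.inl h
      · exact Or.inr ⟨p, List.mem_cons_self, h1, h2⟩
      · exact Or.inr ⟨p', List.mem_cons_of_mem _ hp', h⟩
    · rintro (h | ⟨p', hp', h⟩)
      · exact Or.inl (Or.inl h)
      · rcases List.mem_cons.1 hp' with rfl | hp'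
        · exact Or.inl (Or.inr h)
        · exact Or.inr ⟨p', hp', h⟩

/-- The mask of a finset of points. [this work] -/
def enc (N : Finset (SahiSlot.Q 3 4)) : ℕ := ofBits (fun x => decide (decode x ∈ N)) 64

/-- Bits of `enc`. [this work] -/
theorem testBit_enc (N : Finset (SahiSlot.Q 3 4)) (x : ℕ) : (enc N).testBit x = (decide (x < 64) && decide (decode x ∈ N)) := by
  unfold enc; rw [testBit_ofBits]

/-- The points of `enc N` are the codes of the points of `N`. [this work] -/
theorem mem_ptsOf_enc {N : Finset (SahiSlot.Q 3 4)} {x : ℕ} : x ∈ ptsOf (enc N) ↔ x < 64 ∧ decode x ∈ N := by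
  rw [mem_ptsOf, testBit_enc]; simp

/-- The colouring of codes induced by a colouring of points. [this work] -/
def colOf (c : SahiSlot.Q 3 4 → Fin 4) : ℕ → ℕ := fun x => (c (decode x)).val

section Family

open scoped Classical

/-- The coloured-antichain family of `(N, c)` (prim-sahi-typer's normal form; classical decidability as in `…SaturationColouring`). [this work] -/
noncomputable def colourFamily (N : Finset (SahiSlot.Q 3 4)) (c : SahiSlot.Q 3 4 → Fin 4) (i : Fin 4) : Finset (SahiSlot.Q 3 4) :=
  univ.filter fun q => ∀ p ∈ N, c p = i → ¬ q ≤ p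

/-- Membership in the coloured-antichain family. [this work] -/
theorem mem_colourFamily {N : Finset (SahiSlot.Q 3 4)} {c : SahiSlot.Q 3 4 → Fin 4} {i : Fin 4} {q : SahiSlot.Q 3 4} :
    q ∈ colourFamily N c i ↔ ∀ p ∈ N, c p = i → ¬ q ≤ p := by
  unfold colourFamily; rw [mem_filter]; simp

/-- **The family reached by the search IS the coloured-antichain family.** [this work] -/
theorem memb_finalD (N : Finset (SahiSlot.Q 3 4)) (c : SahiSlot.Q 3 4 → Fin 4) (i : Fin 4) :
    memb (finalD d0 (ptsOf (enc N)) (colOf c)) i = colourFamily N c i := by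
  ext q
  rw [mem_memb, mem_colourFamily]
  have key : (finalD d0 (ptsOf (enc N)) (colOf c) i).testBit (code q) = true ↔ ∃ p ∈ N, c p = i ∧ q ≤ p := by
    rw [testBit_finalD]
    simp only [d0, Nat.zero_testBit, Bool.false_eq_true, false_or]
    constructor
    · rintro ⟨x, hx, hcx, hbit⟩
      obtain ⟨hx64, hxN⟩ := mem_ptsOf_enc.1 hx
      refine ⟨decode x, hxN, Fin.ext ?_, ?_⟩
      · have := (c (decode x)).isLt; unfold colOf at hcx; omega
      · rw [testBit_downMask, ← code_decode hx64] at hbit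
        simp only [code_lt, decide_true, Bool.true_and] at hbit
        exact (cle_code_iff _ _).1 hbit
    · rintro ⟨p, hp, hcp, hqp⟩
      refine ⟨code p, mem_ptsOf_enc.2 ⟨code_lt p, by rw [decode_code]; exact hp⟩, ?_, ?_⟩
      · show (c (decode (code p))).val % 4 = i.val; rw [decode_code, hcp]; exact Nat.mod_eq_of_lt i.isLt
      · rw [testBit_downMask]; simp [code_lt, (cle_code_iff q p).2 hqp]
  constructor
  · intro h p hp hcp hqp
    have := key.2 ⟨p, hp, hcp, hqp⟩
    rw [h] at this; exact Bool.false_ne_true this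
  · intro h
    cases hb : (finalD d0 (ptsOf (enc N)) (colOf c) i).testBit (code q)
    · rfl
    · obtain ⟨p, hp, hcp, hqp⟩ := key.1 hb
      exact absurd hqp (h p hp hcp)

/-- Relabelling the colours of points = relabelling the induced colouring of codes. [this work] -/
theorem colOf_perm (π : Perm (Fin 4)) (c : SahiSlot.Q 3 4 → Fin 4) : colOf (fun q => π (c q)) = relab π (colOf c) := by
  funext x
  have h : (⟨(c (decode x)).val % 4, Nat.mod_lt _ (by norm_num)⟩ : Fin 4) = c (decode x) := Fin.ext (Nat.mod_eq_of_lt (c (decode x)).isLt)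
  unfold relab colOf
  simp only [h]

/-- Permuting the colours permutes the members. [this work] -/
theorem colourFamily_perm (N : Finset (SahiSlot.Q 3 4)) (c : SahiSlot.Q 3 4 → Fin 4) (π : Perm (Fin 4)) (i : Fin 4) :
    colourFamily N (fun q => π (c q)) i = colourFamily N c (π.symm i) := by
  ext q
  rw [mem_colourFamily, mem_colourFamily]
  simp only [Equiv.apply_eq_iff_eq_symm_apply]

/-- The pattern functional of the coloured-antichain family is invariant under colour permutations (`patternForm_perm_slots`). [this work] -/
theorem patternForm_colourFamily_perm (N : Finset (SahiSlot.Q 3 4)) (c : SahiSlot.Q 3 4 → Fin 4) (π : Perm (Fin 4)) :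
    SahiSlot.patternForm 3 4 (fun i => setInd (colourFamily N (fun q => π (c q)) i)) =
      SahiSlot.patternForm 3 4 (fun i => setInd (colourFamily N c i)) := by
  have h : (fun i => setInd (colourFamily N (fun q => π (c q)) i)) = fun i => (fun j => setInd (colourFamily N c j)) (π.symm i) := by
    funext i; rw [colourFamily_perm]
  rw [h]
  exact SahiSlot.patternForm_perm_slots (fun j => setInd (colourFamily N c j)) π.symm

/-- **From the checker to every colouring.**  If the search passes on the mask of `N`, the pattern functional of the coloured-antichain family of
`(N, c)` is nonnegative for EVERY colouring `c`. [this work] -/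
theorem patternForm_colourFamily_nonneg_of_checkMask {N : Finset (SahiSlot.Q 3 4)} (h : checkMask mkCtx (enc N) = true)
    (c : SahiSlot.Q 3 4 → Fin 4) : 0 ≤ SahiSlot.patternForm 3 4 (fun i => setInd (colourFamily N c i)) := by
  obtain ⟨π, hadm⟩ := exists_adm_zero (colOf c) (ptsOf (enc N))
  rw [← patternForm_colourFamily_perm N c π]
  have hfam : (fun i => setInd (colourFamily N (fun q => π (c q)) i)) =
      fun i => setInd (memb (finalD d0 (ptsOf (enc N)) (colOf fun q => π (c q))) i) := by
    funext i; rw [memb_finalD]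
  rw [hfam, patternForm_memb, colOf_perm]
  exact_mod_cast checkMask_sound h _ hadm

end Family

end SahiSlot34

end Summit.CriticalPhenomena.PercolationContinuityZ3.Theorems
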